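import Summits.AtomisticToContinuum.FouriersLaw.Theorems.PhononMeanFreePathKuboFormFouriersLaw
import Summits.AtomisticToContinuum.FouriersLaw.Theorems.PhononMeanFreePathIncoherentChannelVarianceTransportHelper1

/-!
# Stub `fouriersLaw_iff_postConeKubo_of_powerCovLightCone` of line `two-horizons-forecast-loss`
# (crux `PhononMeanFreePath.IncoherentChannel`): the post-cone Kubo form of the conjunct

Registered stub of the lead's skeleton of crux stmt-AtomisticToContinuum-11811
(`Summit.AtomisticToContinuum.FouriersLaw.Theses.PhononMeanFreePath.IncoherentChannel`), proved with exactly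
the registered signature. Write `C_N(t) = powerCov ω₂ lam β γ T N t = Cov_{μ₀}(p_0², K_t p_N²)` for the power
covariance of the two end kinetic energies of the `(N+1)`-site open pinned anharmonic chain with both baths at
temperature `T`, and `G_N = (γ²/T²)∫₀^∞ C_N` for its two-terminal conductance. By the landed, unconditional
`fouriersLaw_iff_kuboForm` the sub-problem conjunct `FouriersLaw` reads `∀ params > 0, ∃ κ > 0, N·G_N → κ`.

The hypothesis `hC` of this file is the FOUR-POINT LIGHT CONE (the lead's stub `powerCov_lightCone`):
for every `η ∈ (0,1)`, `|C_N(t)| ≤ ε_N` for `0 ≤ t ≤ N^η` with `N^{1+η} ε_N → 0`.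

* `preCone_conductance_tendsto_zero_of_powerCovLightCone` — "the conductance has no pre-causal part":
  `N(γ²/T²)∫_{(0,N^η]} C_N → 0`. Proof: the window has Lebesgue measure `N^η` and `|C_N| ≤ ε_N` on it, so
  `‖N(γ²/T²)∫_{(0,N^η]} C_N‖ ≤ (γ²/T²) N^{1+η} ε_N → 0` (`norm_setIntegral_le_of_norm_le_const`; no
  integrability needed).
* `postConeKubo_split` — at fixed `N`, `∫_{(0,∞)} C_N = ∫_{(0,N^η]} C_N + ∫_{(N^η,∞)} C_N` (times `N(γ²/T²)`),
  from the fixed-`N` integrability `powerCov_integrableOn`.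
* `postConeKubo_tendsto_iff` — hence `N·G_N → κ ↔ N(γ²/T²)∫_{(N^η,∞)} C_N → κ`, for every `κ`.
* `fouriersLaw_iff_postConeKubo_of_powerCovLightCone` — the registered stub: combine with
  `fouriersLaw_iff_kuboForm`.

No definition, no `sorry`, standard axioms.
-/

noncomputable section

namespace Summit.AtomisticToContinuum.FouriersLaw.Theorems.PhononMeanFreePath

open MeasureTheory Set Filter Topology
open scoped NNReal
open Literature.MathematicalPhysics.KineticTheory.HeatConduction

/-- **The conductance has no pre-causal part.** Given the four-point light cone `|C_N(t)| ≤ ε_N` on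
`0 ≤ t ≤ N^η` with `N^{1+η} ε_N → 0`, for every `η ∈ (0,1)` and all parameters `> 0`,
`N(γ²/T²)∫_{(0,N^η]} C_N → 0`: the window has measure `N^η`, so the integral is at most `ε_N N^η` in norm
(`norm_setIntegral_le_of_norm_le_const`, no integrability needed), and `N · N^η = N^{1+η}`. [folklore] -/
theorem preCone_conductance_tendsto_zero_of_powerCovLightCone
    (hC : ∀ ω₂ lam β γ : ℝ, 0 < ω₂ → 0 < lam → 0 < β → 0 < γ → ∀ T : ℝ, 0 < T → ∀ η : ℝ, 0 < η → η < 1 →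
      ∃ ε : ℕ → ℝ, Tendsto (fun N : ℕ => (N : ℝ) ^ (1 + η) * ε N) atTop (𝓝 0) ∧
        ∀ (N : ℕ) (t : ℝ), 0 ≤ t → t ≤ (N : ℝ) ^ η → |powerCov ω₂ lam β γ T N t| ≤ ε N)
    {η : ℝ} (hη : 0 < η) (hη1 : η < 1) :
    ∀ ω₂ lam β γ : ℝ, 0 < ω₂ → 0 < lam → 0 < β → 0 < γ → ∀ T : ℝ, 0 < T →
      Tendsto (fun N : ℕ => (N : ℝ) * (γ ^ 2 / T ^ 2) *
        ∫ t in Ioc (0 : ℝ) ((N : ℝ) ^ η), powerCov ω₂ lam β γ T N t) atTop (𝓝 0) := by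
  intro ω₂ lam β γ hω hl hβ hγ T hT
  obtain ⟨ε, hε, hCε⟩ := hC ω₂ lam β γ hω hl hβ hγ T hT η hη hη1
  -- the bound `‖N(γ²/T²)∫_{(0,N^η]} C_N‖ ≤ (γ²/T²) N^{1+η} ε_N` at every `N`
  have hbound : ∀ N : ℕ, ‖(N : ℝ) * (γ ^ 2 / T ^ 2) *
      ∫ t in Ioc (0 : ℝ) ((N : ℝ) ^ η), powerCov ω₂ lam β γ T N t‖ ≤
      (γ ^ 2 / T ^ 2) * ((N : ℝ) ^ (1 + η) * ε N) := by
    intro N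
    have hN0 : (0 : ℝ) ≤ N := Nat.cast_nonneg N
    have hNη : (0 : ℝ) ≤ (N : ℝ) ^ η := Real.rpow_nonneg hN0 η
    have h1 : ‖∫ t in Ioc (0 : ℝ) ((N : ℝ) ^ η), powerCov ω₂ lam β γ T N t‖ ≤
        ε N * volume.real (Ioc (0 : ℝ) ((N : ℝ) ^ η)) := by
      refine norm_setIntegral_le_of_norm_le_const measure_Ioc_lt_top fun t ht => ?_
      rw [Real.norm_eq_abs]
      exact hCε N t ht.1.le ht.2
    rw [Real.volume_real_Ioc_of_le hNη, sub_zero] at h1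
    have e : (N : ℝ) ^ (1 + η) = (N : ℝ) * (N : ℝ) ^ η := by
      rw [Real.rpow_add' hN0 (by linarith : (0 : ℝ) < 1 + η).ne', Real.rpow_one]
    rw [norm_mul, norm_mul, Real.norm_natCast,
      Real.norm_of_nonneg (by positivity : (0 : ℝ) ≤ γ ^ 2 / T ^ 2), e]
    calc (N : ℝ) * (γ ^ 2 / T ^ 2) * ‖∫ t in Ioc (0 : ℝ) ((N : ℝ) ^ η), powerCov ω₂ lam β γ T N t‖ ≤
        (N : ℝ) * (γ ^ 2 / T ^ 2) * (ε N * (N : ℝ) ^ η) :=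
          mul_le_mul_of_nonneg_left h1 (by positivity)
      _ = (γ ^ 2 / T ^ 2) * ((N : ℝ) * (N : ℝ) ^ η * ε N) := by ring
  have hlim : Tendsto (fun N : ℕ => (γ ^ 2 / T ^ 2) * ((N : ℝ) ^ (1 + η) * ε N)) atTop (𝓝 0) := by
    simpa using hε.const_mul (γ ^ 2 / T ^ 2)
  exact squeeze_zero_norm hbound hlim

/-- Fixed-`N` splitting of the Kubo sequence at the light-cone time `N^η`:
`N(γ²/T²)∫_{(0,∞)} C_N = N(γ²/T²)∫_{(0,N^η]} C_N + N(γ²/T²)∫_{(N^η,∞)} C_N`, by the fixed-`N` integrability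
of `C_N` on `(0,∞)` (`powerCov_integrableOn`). [folklore] -/
theorem postConeKubo_split {ω₂ lam β γ T : ℝ} (hω : 0 < ω₂) (hl : 0 < lam) (hβ : 0 < β) (hγ : 0 < γ)
    (hT : 0 < T) (η : ℝ) (N : ℕ) :
    (N : ℝ) * (γ ^ 2 / T ^ 2) * (∫ t in Ioi (0 : ℝ), powerCov ω₂ lam β γ T N t) =
      (N : ℝ) * (γ ^ 2 / T ^ 2) * (∫ t in Ioc (0 : ℝ) ((N : ℝ) ^ η), powerCov ω₂ lam β γ T N t) +
        (N : ℝ) * (γ ^ 2 / T ^ 2) * (∫ t in Ioi ((N : ℝ) ^ η), powerCov ω₂ lam β γ T N t) := by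
  have hNη : (0 : ℝ) ≤ (N : ℝ) ^ η := Real.rpow_nonneg (Nat.cast_nonneg N) η
  have hf : IntegrableOn (powerCov ω₂ lam β γ T N) (Ioi (0 : ℝ)) :=
    powerCov_integrableOn ω₂ lam β γ hω hl hβ hγ T hT N
  rw [← mul_add, ← setIntegral_union (Ioc_disjoint_Ioi le_rfl) measurableSet_Ioi
    (hf.mono_set Ioc_subset_Ioi_self) (hf.mono_set (Ioi_subset_Ioi hNη)), Ioc_union_Ioi_eq_Ioi hNη]

/-- Given the four-point light cone, at every parameter point and every `κ`, the Kubo sequence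
`N·G_N = N(γ²/T²)∫_{(0,∞)} C_N` tends to `κ` iff its post-cone part `N(γ²/T²)∫_{(N^η,∞)} C_N` does: the causal
window contributes `→ 0` (`preCone_conductance_tendsto_zero_of_powerCovLightCone`). [folklore] -/
theorem postConeKubo_tendsto_iff
    (hC : ∀ ω₂ lam β γ : ℝ, 0 < ω₂ → 0 < lam → 0 < β → 0 < γ → ∀ T : ℝ, 0 < T → ∀ η : ℝ, 0 < η → η < 1 →
      ∃ ε : ℕ → ℝ, Tendsto (fun N : ℕ => (N : ℝ) ^ (1 + η) * ε N) atTop (𝓝 0) ∧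
        ∀ (N : ℕ) (t : ℝ), 0 ≤ t → t ≤ (N : ℝ) ^ η → |powerCov ω₂ lam β γ T N t| ≤ ε N)
    {η : ℝ} (hη : 0 < η) (hη1 : η < 1) {ω₂ lam β γ T : ℝ} (hω : 0 < ω₂) (hl : 0 < lam) (hβ : 0 < β)
    (hγ : 0 < γ) (hT : 0 < T) (κ : ℝ) :
    Tendsto (fun N : ℕ => (N : ℝ) * (γ ^ 2 / T ^ 2) *
        ∫ t in Ioi (0 : ℝ), powerCov ω₂ lam β γ T N t) atTop (𝓝 κ) ↔
      Tendsto (fun N : ℕ => (N : ℝ) * (γ ^ 2 / T ^ 2) *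
        ∫ t in Ioi ((N : ℝ) ^ η), powerCov ω₂ lam β γ T N t) atTop (𝓝 κ) := by
  have h0 := preCone_conductance_tendsto_zero_of_powerCovLightCone hC hη hη1 ω₂ lam β γ hω hl hβ hγ T hT
  constructor
  · intro h
    have h' := h.sub h0
    rw [sub_zero] at h'
    refine h'.congr fun N => ?_
    rw [postConeKubo_split hω hl hβ hγ hT η N]
    ring
  · intro h
    have h' := h0.add h
    rw [zero_add] at h'
    exact h'.congr fun N => (postConeKubo_split hω hl hβ hγ hT η N).symm

/-- **Registered stub (c9) `fouriersLaw_iff_postConeKubo_of_powerCovLightCone`** — POST-CONE KUBO FORM OF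
THE CONJUNCT: given the four-point light cone, for every `η ∈ (0,1)`,
`FouriersLaw ↔ ∀ params > 0, ∃ κ > 0, N(γ²/T²)∫_{(N^η,∞)} C_N → κ` (from the unconditional
`fouriersLaw_iff_kuboForm` and the fixed-`N` integrability `powerCov_integrableOn`): the two-terminal
conductance has no pre-causal part (`preCone_conductance_tendsto_zero_of_powerCovLightCone`). [folklore] -/
theorem fouriersLaw_iff_postConeKubo_of_powerCovLightCone
    (hC : ∀ ω₂ lam β γ : ℝ, 0 < ω₂ → 0 < lam → 0 < β → 0 < γ → ∀ T : ℝ, 0 < T → ∀ η : ℝ, 0 < η → η < 1 →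
      ∃ ε : ℕ → ℝ, Tendsto (fun N : ℕ => (N : ℝ) ^ (1 + η) * ε N) atTop (𝓝 0) ∧
        ∀ (N : ℕ) (t : ℝ), 0 ≤ t → t ≤ (N : ℝ) ^ η → |powerCov ω₂ lam β γ T N t| ≤ ε N)
    {η : ℝ} (hη : 0 < η) (hη1 : η < 1) :
    _root_.FouriersLaw ↔
      ∀ ω₂ lam β γ : ℝ, 0 < ω₂ → 0 < lam → 0 < β → 0 < γ → ∀ T : ℝ, 0 < T →
        ∃ κ : ℝ, 0 < κ ∧ Tendsto (fun N : ℕ => (N : ℝ) * (γ ^ 2 / T ^ 2) *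
          ∫ t in Ioi ((N : ℝ) ^ η), powerCov ω₂ lam β γ T N t) atTop (𝓝 κ) := by
  rw [fouriersLaw_iff_kuboForm]
  constructor
  · intro h ω₂ lam β γ hω hl hβ hγ T hT
    obtain ⟨κ, hκ, hlim⟩ := h ω₂ lam β γ hω hl hβ hγ T hT
    exact ⟨κ, hκ, (postConeKubo_tendsto_iff hC hη hη1 hω hl hβ hγ hT κ).1 hlim⟩
  · intro h ω₂ lam β γ hω hl hβ hγ T hT
    obtain ⟨κ, hκ, hlim⟩ := h ω₂ lam β γ hω hl hβ hγ T hT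
    exact ⟨κ, hκ, (postConeKubo_tendsto_iff hC hη hη1 hω hl hβ hγ hT κ).2 hlim⟩

end Summit.AtomisticToContinuum.FouriersLaw.Theorems.PhononMeanFreePath

end
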